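import Summits.CriticalPhenomena.SAWScalingLimit.Theorems.SAWDefectDecoherenceBoundaryClosureRRootWedgeEscape
import Summits.CriticalPhenomena.SAWScalingLimit.Theorems.SAWDefectDecoherenceBoundaryClosureRRootWedgeRim
import HarnessLib

/-!
# The root wedge bound from no-interior-maximum and the local sup law (crux `BoundaryClosureR`,
stmt-CriticalPhenomena-14004, line `pick-half-plane`, stub
`stub_rootWedgeOfNoMax : RootNoInteriorMax → LocalSupBound → RootWedgeBound`)

`RootWedgeBound` asks for ONE `M` with, eventually as `δ → 0+`, `δ·(Re H s − Re H s_b) ≤ M·Z(b δ)`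
for every potential `H` of the root-`e δ` observable (root frame, `F(e δ) = 1`), every normaliser
site `s_b` and every lattice site `s` of `Λ δ` with `δ s ∈ closedBall x (r/2)`.  Proof
(`rootWedgeBound_of_noInteriorMax`, the registered statement with the line-local definitions
unfolded verbatim): the DISCRETE MAXIMUM PRINCIPLE on the lattice sites of the closed half-ball.
The maximum of `Re H` there sits at an interior site — which by `RootNoInteriorMax` has a neighbour
with larger `Re H`, necessarily one step outside — or at a non-interior site, which by the exact
half-lattice pin is a FLOOR site, from which `Re H` does not decrease walking along the floor away
from the root (V-shape from the landed `floor_step_eq`/`root_step_eq`) until the half-ball is left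
(landed `RootWedge.escape`).  The exit site lies in the thin annulus `r/2 < ‖δ t − x‖ ≤ r/2 + δ`
above the floor, where the two-sided `RootWedge.rim_bound` `δ‖H t − H s_b‖ ≤ B‖F(b δ)‖` holds
(the local sup law `LocalSupBound`, chained from the normaliser along a path in the carrier and
around finitely many rim stations); finally `‖F_{5/8}(b δ)‖ = Z(b δ)` at the boundary normaliser.

References: H. Duminil-Copin, S. Smirnov, Ann. of Math. 175 (2012), §3–§4.
-/

noncomputable section

open scoped Topology
open Filter Set
open Literature.Probability.LatticeModels Literature.Probability.RandomPlanarGeometry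
open Literature.Probability.RandomPlanarGeometry.SAW
open Summit.CriticalPhenomena.SAWScalingLimit.Theorems.PickHalfPlane.DevelopingMaps

namespace Summit.CriticalPhenomena.SAWScalingLimit.Theorems.PickHalfPlane.RootWedge

/-! ### The root wedge bound -/

/-- **The root wedge bound from no-interior-maximum and the local sup law** (stub
`stub_rootWedgeOfNoMax : RootNoInteriorMax → LocalSupBound → RootWedgeBound` of the line
`pick-half-plane`, the three statements of the skeleton with `AdmissibleFamily`, `PinnedFlatRoot`,
`flatPoints` unfolded verbatim): for an admissible family and a pinned flat root `x ≠ D.pt 1` there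
is ONE `M` with, eventually as `δ → 0+`, `δ·(Re H s − Re H s_b) ≤ M·Z(b δ)` for every potential
`H` of the root-`e δ` observable, every normaliser site `s_b` and every lattice site `s` with
`δ s ∈ closedBall x (r/2)`.  DISCRETE MAXIMUM PRINCIPLE on the lattice sites of the closed
half-ball: the maximum of `Re H` there is attained at an interior site — which by
`RootNoInteriorMax` has a neighbour with larger `Re H`, necessarily one step outside the half-ball —
or at a non-interior site, which by the exact half-lattice pin is a FLOOR site, from which `Re H`
does not decrease walking along the floor away from the root (V-shape: `floor_step_eq`,
`root_step_eq`) until the half-ball is left (`escape`); the exit site lies in the thin annulus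
`r/2 < ‖δ t − x‖ ≤ r/2 + δ` above the floor, where the two-sided `rim_bound`
`δ‖H t − H s_b‖ ≤ B‖F(b δ)‖` (local sup law, chained from the normaliser) applies; finally
`‖F_{5/8}(b δ)‖ = Z(b δ)` at the boundary normaliser. [cite: DuminilCopinSmirnov2012, §4 (the map H with dH = F dz)] -/
theorem rootWedgeBound_of_noInteriorMax :
    (∀ (D : DobrushinDomain) (ρ : ℝ) (Λ : ℝ → Finset HexVertex) (m : ℝ → ℤ) (b : ℝ → Sym2
    HexVertex), (0 < ρ∧D.carrier ∩ Metric.ball (D.pt 1) ρ = {z : ℂ | (D.pt 1).im < z.im} ∩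
    Metric.ball (D.pt 1) ρ∧(∀ᶠ δ : ℝ in 𝓝[>] 0, hexDomainSimplyConnected (Λ δ)∧b δ ∈
    hexDomainBoundary (Λ δ)∧(hexGraph.induce ↑(Λ δ)).Preconnected∧(∀ v ∈ Λ δ, (δ : ℂ) * hexCenter v
    ∈ D.carrier)∧(∀ v, (δ : ℂ) * hexCenter v ∈ Metric.ball (D.pt 1) ρ → (v ∈ Λ δ ↔ m δ ≤ v.1 1)))∧(∀
    K : Set ℂ, IsCompact K → K ⊆ D.carrier → ∀ᶠ δ : ℝ in 𝓝[>] 0, ∀ v, (δ : ℂ) * hexCenter v ∈ K → v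
    ∈ Λ δ)∧Tendsto (fun δ : ℝ => (δ : ℂ) * hexMidpoint (b δ)) (𝓝[>] 0) (𝓝 (D.pt 1))) → ∀ (x : ℂ) (e
    : ℝ → Sym2 HexVertex) (r : ℝ) (mr : ℝ → ℤ), (0 < r∧D.carrier ∩ Metric.ball x r = {z : ℂ | x.im <
    z.im} ∩ Metric.ball x r∧(∀ᶠ δ : ℝ in 𝓝[>] 0, e δ ∈ hexDomainBoundary (Λ δ)∧Nonempty
    (HexMidEdgeSAW (Λ δ) (e δ) (b δ))∧(∀ v, (δ : ℂ) * hexCenter v ∈ Metric.ball x r → (v ∈ Λ δ ↔ mr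
    δ ≤ v.1 1)))∧Tendsto (fun δ : ℝ => (δ : ℂ) * hexMidpoint (e δ)) (𝓝[>] 0) (𝓝 x)) → x ≠ D.pt 1 →
    ∀ᶠ δ : ℝ in 𝓝[>] 0, ∀ H : Site 2 → ℂ, IsPotential (Λ δ) (e δ) H → ∀ s : Site 2, IsInteriorSite
    (Λ δ) s → (δ : ℂ) * triEmbed s ∈ Metric.closedBall x (r/2) → ∃ t ∈ siteNbrs s, (H s).re < (H
    t).re) → (∀ (D : DobrushinDomain) (ρ : ℝ) (Λ : ℝ → Finset HexVertex) (m : ℝ → ℤ) (b : ℝ → Sym2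
    HexVertex), (0 < ρ∧D.carrier ∩ Metric.ball (D.pt 1) ρ = {z : ℂ | (D.pt 1).im < z.im} ∩
    Metric.ball (D.pt 1) ρ∧(∀ᶠ δ : ℝ in 𝓝[>] 0, hexDomainSimplyConnected (Λ δ)∧b δ ∈
    hexDomainBoundary (Λ δ)∧(hexGraph.induce ↑(Λ δ)).Preconnected∧(∀ v ∈ Λ δ, (δ : ℂ) * hexCenter v
    ∈ D.carrier)∧(∀ v, (δ : ℂ) * hexCenter v ∈ Metric.ball (D.pt 1) ρ → (v ∈ Λ δ ↔ m δ ≤ v.1 1)))∧(∀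
    K : Set ℂ, IsCompact K → K ⊆ D.carrier → ∀ᶠ δ : ℝ in 𝓝[>] 0, ∀ v, (δ : ℂ) * hexCenter v ∈ K → v
    ∈ Λ δ)∧Tendsto (fun δ : ℝ => (δ : ℂ) * hexMidpoint (b δ)) (𝓝[>] 0) (𝓝 (D.pt 1))) → ∀ (x : ℂ) (e
    : ℝ → Sym2 HexVertex) (r : ℝ) (mr : ℝ → ℤ), (0 < r∧D.carrier ∩ Metric.ball x r = {z : ℂ | x.im <
    z.im} ∩ Metric.ball x r∧(∀ᶠ δ : ℝ in 𝓝[>] 0, e δ ∈ hexDomainBoundary (Λ δ)∧Nonempty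
    (HexMidEdgeSAW (Λ δ) (e δ) (b δ))∧(∀ v, (δ : ℂ) * hexCenter v ∈ Metric.ball x r → (v ∈ Λ δ ↔ mr
    δ ≤ v.1 1)))∧Tendsto (fun δ : ℝ => (δ : ℂ) * hexMidpoint (e δ)) (𝓝[>] 0) (𝓝 x)) → x ≠ D.pt 1 → ∀
    K : Set ℂ, IsCompact K → K ⊆ D.carrier ∪ (({z : ℂ | z.im = (D.pt 1).im} ∩ Metric.ball (D.pt 1)
    ρ) ∪ ({z : ℂ | z.im = x.im} ∩ Metric.ball x r)) → x ∉ K → ∃ C : ℝ, ∀ᶠ δ : ℝ in 𝓝[>] 0, ∀ z ∈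
    hexDomainMidEdges (Λ δ), (δ : ℂ) * hexMidpoint z ∈ K → ‖hexParafermionicObservable (Λ δ) (e δ)
    hexCriticalFugacity (5/8) z‖ ≤ C * ‖hexParafermionicObservable (Λ δ) (e δ) hexCriticalFugacity
    (5/8) (b δ)‖) → ∀ (D : DobrushinDomain) (ρ : ℝ) (Λ : ℝ → Finset HexVertex) (m : ℝ → ℤ) (b : ℝ →
    Sym2 HexVertex), (0 < ρ∧D.carrier ∩ Metric.ball (D.pt 1) ρ = {z : ℂ | (D.pt 1).im < z.im} ∩
    Metric.ball (D.pt 1) ρ∧(∀ᶠ δ : ℝ in 𝓝[>] 0, hexDomainSimplyConnected (Λ δ)∧b δ ∈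
    hexDomainBoundary (Λ δ)∧(hexGraph.induce ↑(Λ δ)).Preconnected∧(∀ v ∈ Λ δ, (δ : ℂ) * hexCenter v
    ∈ D.carrier)∧(∀ v, (δ : ℂ) * hexCenter v ∈ Metric.ball (D.pt 1) ρ → (v ∈ Λ δ ↔ m δ ≤ v.1 1)))∧(∀
    K : Set ℂ, IsCompact K → K ⊆ D.carrier → ∀ᶠ δ : ℝ in 𝓝[>] 0, ∀ v, (δ : ℂ) * hexCenter v ∈ K → v
    ∈ Λ δ)∧Tendsto (fun δ : ℝ => (δ : ℂ) * hexMidpoint (b δ)) (𝓝[>] 0) (𝓝 (D.pt 1))) → ∀ (x : ℂ) (e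
    : ℝ → Sym2 HexVertex) (r : ℝ) (mr : ℝ → ℤ), (0 < r∧D.carrier ∩ Metric.ball x r = {z : ℂ | x.im <
    z.im} ∩ Metric.ball x r∧(∀ᶠ δ : ℝ in 𝓝[>] 0, e δ ∈ hexDomainBoundary (Λ δ)∧Nonempty
    (HexMidEdgeSAW (Λ δ) (e δ) (b δ))∧(∀ v, (δ : ℂ) * hexCenter v ∈ Metric.ball x r → (v ∈ Λ δ ↔ mr
    δ ≤ v.1 1)))∧Tendsto (fun δ : ℝ => (δ : ℂ) * hexMidpoint (e δ)) (𝓝[>] 0) (𝓝 x)) → x ≠ D.pt 1 → ∃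
    M : ℝ, ∀ᶠ δ : ℝ in 𝓝[>] 0, ∀ H : Site 2 → ℂ, IsPotential (Λ δ) (e δ) H → ∀ (ub wb : HexVertex),
    b δ = s(ub, wb) → ∀ sb : Site 2, sb ∈ hexFaceVertices ub → sb ∈ hexFaceVertices wb → ∀ v ∈ Λ δ,
    ∀ s ∈ hexFaceVertices v, (δ : ℂ) * triEmbed s ∈ Metric.closedBall x (r/2) → δ * ((H s).re - (H
    sb).re) ≤ M * ‖hexParafermionicObservable (Λ δ) (e δ) hexCriticalFugacity 0 (b δ)‖ := by
  intro hNoMax hSupAll D ρ Λ m b hAF x e r mr hPR hx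
  have hSup := hSupAll D ρ Λ m b hAF x e r mr hPR hx
  obtain ⟨B, hB0, hRim⟩ := rim_bound hAF hPR hx hSup
  refine ⟨B, ?_⟩
  have hr : 0 < r := hPR.1
  have hmax := hNoMax D ρ Λ m b hAF x e r mr hPR hx
  obtain ⟨_, _, hev, _, _⟩ := hAF
  have hframe := pinned_frame (Ω := D.carrier) (bf := e) hr (by positivity : (0 : ℝ) < r / 200)
    hPR.2.1 (hPR.2.2.1.mono fun δ h => h.2.2) (hPR.2.2.1.mono fun δ h => h.1)
    (hev.mono fun δ h => h.2.2.2.1) hPR.2.2.2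
  have hnorm := LocalL1.eventually_normaliser_ne_zero_of_bundles hev hPR.2.2.1
  have hδev : ∀ᶠ δ : ℝ in 𝓝[>] 0, δ ∈ Set.Ioo 0 (r / 100) := Ioo_mem_nhdsGT (by positivity)
  filter_upwards [hRim, hmax, hframe, hnorm, hev, hPR.2.2.1, hδev] with δ hRimδ hmaxδ hfrδ hnormδ hevδ
    hPRδ hδI H hH ub wb hb sb hsbu hsbw v hv s hs hsball
  obtain ⟨⟨ka, hka⟩, hnear, _, _⟩ := hfrδ
  obtain ⟨hsc, _, _, _, _⟩ := hevδ
  obtain ⟨_, _, hpin⟩ := hPRδ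
  obtain ⟨hδ0, hδr⟩ := hδI
  set M : ℤ := mr δ with hM
  -- the flat range `[ka - N, ka + N]`
  set N : ℤ := ⌊(9 * r / 10) / δ⌋ with hN
  have hN1 : δ * (N : ℝ) ≤ 9 * r / 10 := by
    have h := Int.floor_le ((9 * r / 10) / δ)
    have := mul_le_mul_of_nonneg_left h hδ0.le
    rwa [mul_div_cancel₀ _ hδ0.ne'] at this
  have hN2 : 9 * r / 10 - δ < δ * (N : ℝ) := by
    have h := Int.lt_floor_add_one ((9 * r / 10) / δ)
    have := mul_lt_mul_of_pos_left h hδ0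
    rw [mul_add, mul_one, mul_div_cancel₀ _ hδ0.ne'] at this
    linarith
  have hN0 : 0 ≤ N := Int.floor_nonneg.2 (by positivity)
  -- distances along the floor row
  have hroot : ‖(δ : ℂ) * triEmbed ![ka, M] - x‖ ≤ r / 200 + δ := by
    refine norm_scaled_sub_le (t := hexMidpoint (floorEdge ka M)) hδ0.le ?_ (by rw [← hka]; exact hnear.le)
    rw [hexMidpoint_floorEdge, show triEmbed ![ka, M] - (triEmbed ![ka, M] + 1 / 2) = -(1 / 2 : ℂ)
      by ring]
    norm_num
  have hcoldist : ∀ k : ℤ, ‖(δ : ℂ) * triEmbed ![k, M] - (δ : ℂ) * triEmbed ![ka, M]‖ =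
      δ * |((k - ka : ℤ) : ℝ)| := by
    intro k
    rw [norm_smul_sub hδ0.le]
    congr 1
    have : triEmbed ![k, M] - triEmbed ![ka, M] = ((k - ka : ℤ) : ℂ) := by
      simp [triEmbed]
    rw [this, Complex.norm_intCast]
  -- the flat-floor clauses on the range
  have hF : ∀ k : ℤ, ka - N ≤ k → k ≤ ka + N → ((![k, M], 0) : HexVertex) ∈ Λ δ ∧
      ((![k, M - 1], 1) : HexVertex) ∉ Λ δ ∧ (k < ka + N → ((![k, M], 1) : HexVertex) ∈ Λ δ) := by
    intro k hk1 hk2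
    have habs : |((k - ka : ℤ) : ℝ)| ≤ N := by
      rw [show (N : ℝ) = ((N : ℤ) : ℝ) from rfl]
      exact_mod_cast abs_le.2 ⟨by omega, by omega⟩
    have hk : ‖(δ : ℂ) * triEmbed ![k, M] - x‖ ≤ 9 * r / 10 + r / 200 + δ := by
      calc ‖(δ : ℂ) * triEmbed ![k, M] - x‖
          ≤ ‖(δ : ℂ) * triEmbed ![k, M] - (δ : ℂ) * triEmbed ![ka, M]‖ +
            ‖(δ : ℂ) * triEmbed ![ka, M] - x‖ := norm_sub_le_norm_sub_add_norm_sub _ _ _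
        _ ≤ δ * N + (r / 200 + δ) := by
            rw [hcoldist]; exact add_le_add (mul_le_mul_of_nonneg_left habs hδ0.le) hroot
        _ ≤ 9 * r / 10 + r / 200 + δ := by linarith
    have hball : ∀ u : ℂ, ‖u - triEmbed ![k, M]‖ ≤ 2 → (δ : ℂ) * u ∈ Metric.ball x r := by
      intro u hu
      rw [Metric.mem_ball, dist_eq_norm]
      have h1 : ‖(δ : ℂ) * u - (δ : ℂ) * triEmbed ![k, M]‖ ≤ 2 * δ := by
        rw [norm_smul_sub hδ0.le]; nlinarith
      calc ‖(δ : ℂ) * u - x‖ ≤ ‖(δ : ℂ) * u - (δ : ℂ) * triEmbed ![k, M]‖ +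
            ‖(δ : ℂ) * triEmbed ![k, M] - x‖ := norm_sub_le_norm_sub_add_norm_sub _ _ _
        _ < r := by linarith
    obtain ⟨g1, g2, g3⟩ := floorFaces_near k M
    refine ⟨(hpin _ (hball _ g1)).2 (show M ≤ M from le_rfl), fun h => ?_,
      fun _ => (hpin _ (hball _ g3)).2 (show M ≤ M from le_rfl)⟩
    have := (hpin _ (hball _ g2)).1 h
    simp [belowFace] at this
  have hka₁ : ka - N ≤ ka := by omega
  have hka₂ : ka ≤ ka + N := by omega
  -- the region
  set P : Site 2 → Prop := fun s => (δ : ℂ) * triEmbed s ∈ Metric.closedBall x (r / 2) with hP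
  have hcol : ∀ k : ℤ, P ![k, M] → ka - N < k ∧ k < ka + N := by
    intro k hk
    have hk' : ‖(δ : ℂ) * triEmbed ![k, M] - x‖ ≤ r / 2 := by
      have := Metric.mem_closedBall.1 hk; rwa [dist_eq_norm] at this
    have h1 : δ * |((k - ka : ℤ) : ℝ)| ≤ r / 2 + (r / 200 + δ) := by
      rw [← hcoldist]
      calc ‖(δ : ℂ) * triEmbed ![k, M] - (δ : ℂ) * triEmbed ![ka, M]‖
          ≤ ‖(δ : ℂ) * triEmbed ![k, M] - x‖ + ‖x - (δ : ℂ) * triEmbed ![ka, M]‖ :=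
            norm_sub_le_norm_sub_add_norm_sub _ _ _
        _ ≤ r / 2 + (r / 200 + δ) := by rw [norm_sub_rev x]; exact add_le_add hk' hroot
    have h2 : δ * |((k - ka : ℤ) : ℝ)| < δ * N := by linarith
    have h3 : |((k - ka : ℤ) : ℝ)| < N := lt_of_mul_lt_mul_left h2 hδ0.le
    have h4 : |k - ka| < N := by
      have : (|k - ka| : ℝ) < (N : ℝ) := by exact_mod_cast h3
      exact_mod_cast this
    constructor <;> [have := (abs_lt.1 h4).1; have := (abs_lt.1 h4).2] <;> omega
  have hrowP : ∀ s : Site 2, IsLatticeSite (Λ δ) s → ¬ IsInteriorSite (Λ δ) s → P s → s 1 = M := by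
    intro s' hsL hsI hsP
    have hs'x : ‖(δ : ℂ) * triEmbed s' - x‖ ≤ r / 2 := by
      have := Metric.mem_closedBall.1 hsP; rwa [dist_eq_norm] at this
    have hfaceball : ∀ f : HexVertex, s' ∈ hexFaceVertices f → (δ : ℂ) * hexCenter f ∈ Metric.ball x r := by
      intro f hf
      rw [Metric.mem_ball, dist_eq_norm]
      have h1 := norm_triEmbed_sub_hexCenter_le hf
      rw [norm_sub_rev] at h1
      have := norm_scaled_sub_le hδ0.le h1 hs'x
      linarith
    obtain ⟨f, hf, hfΛ⟩ : ∃ f : HexVertex, s' ∈ hexFaceVertices f ∧ f ∉ Λ δ := by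
      have h := hsI
      simp only [IsInteriorSite, not_forall, exists_prop] at h
      exact h
    obtain ⟨v', hv', hs'v⟩ := hsL
    have hv'row : M ≤ v'.1 1 := (hpin _ (hfaceball v' hs'v)).1 hv'
    have hfrow : ¬ M ≤ f.1 1 := fun h => hfΛ ((hpin _ (hfaceball f hf)).2 h)
    have r1 := rows_of_mem_hexFaceVertices hs'v
    have r2 := rows_of_mem_hexFaceVertices hf
    omega
  have hmaxP : ∀ s : Site 2, IsInteriorSite (Λ δ) s → P s → ∃ t ∈ siteNbrs s, (H s).re < (H t).re :=
    fun s' hsI hsP => hmaxδ H hH s' hsI hsP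
  -- the escape
  rw [hka] at hH
  obtain ⟨s₁, t, hs₁L, hs₁P, ht, htL, htP, hle⟩ :=
    escape hsc hF hka₁ hka₂ hH P hmaxP hrowP hcol ⟨v, hv, hs⟩ hsball
  rw [← hka] at hH
  -- the exit lies in the thin annulus above the floor
  have hs₁x : ‖(δ : ℂ) * triEmbed s₁ - x‖ ≤ r / 2 := by
    have := Metric.mem_closedBall.1 hs₁P; rwa [dist_eq_norm] at this
  have ht1 : r / 2 < ‖(δ : ℂ) * triEmbed t - x‖ := by
    by_contra h
    exact htP (Metric.mem_closedBall.2 (by rw [dist_eq_norm]; exact not_lt.1 h))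
  have ht2 : ‖(δ : ℂ) * triEmbed t - x‖ ≤ r / 2 + δ :=
    norm_scaled_sub_le hδ0.le (norm_sub_le_one_of_mem_siteNbrs ht) hs₁x
  have htrow : M ≤ t 1 := by
    obtain ⟨v', hv', htv⟩ := htL
    have h1 := norm_triEmbed_sub_hexCenter_le htv
    rw [norm_sub_rev] at h1
    have h2 := norm_scaled_sub_le hδ0.le h1 ht2
    have hball : (δ : ℂ) * hexCenter v' ∈ Metric.ball x r := by
      rw [Metric.mem_ball, dist_eq_norm]; linarith
    have := (hpin _ hball).1 hv'
    have r1 := rows_of_mem_hexFaceVertices htv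
    omega
  have key := hRimδ H hH ub wb hb sb hsbu hsbw t htrow ht1 ht2
  -- conclusion
  rw [← hnormδ.2]
  have hre : (H t).re - (H sb).re ≤ ‖H t - H sb‖ := by
    rw [← Complex.sub_re]; exact Complex.re_le_norm _
  calc δ * ((H s).re - (H sb).re) ≤ δ * ((H t).re - (H sb).re) :=
        mul_le_mul_of_nonneg_left (by linarith) hδ0.le
    _ ≤ δ * ‖H t - H sb‖ := mul_le_mul_of_nonneg_left hre hδ0.le
    _ ≤ B * ‖hexParafermionicObservable (Λ δ) (e δ) hexCriticalFugacity (5 / 8) (b δ)‖ := key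

end Summit.CriticalPhenomena.SAWScalingLimit.Theorems.PickHalfPlane.RootWedge

end
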